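import Summits.NavierStokesRegularity.NavierStokesRegularity.Theorems.FrozenSignCascadeBoundedEnvelopeContinuationMorreyTypeIBound
import Summits.NavierStokesRegularity.NavierStokesRegularity.Theorems.HardyPointSinkHardyAncientLimitClassical
import Literature.Analysis.FluidPDE.LocalTypeIReverse
import Literature.Analysis.FluidPDE.LocalTypeIProofs
import Literature.Analysis.FluidPDE.LocalTypeIPersistenceHolds
import Literature.Analysis.FluidPDE.SelfSimilar
import Summits.NavierStokesRegularity.NavierStokesRegularity.Theorems.RellichScarApexLocalisationGlue
import HarnessLib

/-!
# Route FrozenSignCascade · crux `BoundedEnvelopeContinuation` — stub Z5: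
# `¬ LocalTypeISingularityExists` implies the Morrey–Liouville statement (L_M)

Helper file for the crux item stmt-NavierStokesRegularity-10579 (`BoundedEnvelopeContinuation`,
conjunct (B) of route `FrozenSignCascade`); lands `--supports` that item (stub
`stub_liouvilleMorreyOfNoLocalTypeI` of the registered line, reshape r3).

(L_M): a bounded ancient mild solution `v` (`ν = 1`) on `(-∞,0) × (EuclideanSpace ℝ (Fin 3))`, jointly smooth and
Oseen-mild there, whose slices obey the scale-invariant Morrey bound `∫_{B_r(y)} ‖v t‖² ≤ M r`
at ALL radii, vanishes identically. `stub_liouvilleMorreyOfNoLocalTypeI` proves (L_M) from the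
registered open statement `¬ LocalTypeISingularityExists` (Albritton–Barker 2019, Thm 1.1, first
bullet): a non-trivial such `v`, with the classical pressure `P` of
`HardyAncientLimit.exists_isClassicalNSSolutionOn_Iio_of_oseen` and `∇v`, is a suitable weak
solution on the past slab (classical ⇒ suitable, `isSuitableWeakSolutionOn_of_contDiffOn`), not
a.e. zero (`RellichScarApexLocalisation.not_ae_eq_zero_of_continuousOn`), with `𝐈((EuclideanSpace ℝ (Fin 3)) × ℝ₋) < ∞`
(`typeIBound_slab_lt_top_of_morrey`, the work of `…MorreyUnitScale.lean` and
`…MorreyTypeIBound.lean`) — a witness of `NontrivialMildAncientTypeIExists`, whence a local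
Type I singular point by the tree's reverse direction of Thm 1.1
(`localTypeISingularityExists_of_nontrivialMildAncientTypeIExists`, `SuitableCompactness_holds`,
`PersistenceOfSingularities_holds`).

## References

* D. Albritton, T. Barker, J. Math. Fluid Mech. 21 (2019) = arXiv:1811.00502, Thm 1.1, §3,
  Lemma 2.6. [AlbrittonBarker2019]
* G. Koch, N. Nadirashvili, G. Seregin, V. Šverák, Acta Math. 203 (2009), §1.
  [KochNadirashviliSereginSverak2009]
-/

noncomputable section

set_option linter.dupNamespace false -- nested layout Summit.<S>.<Sub>, Sub = S (D-0017)

open Set MeasureTheory Filter Topology Metric Function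
open scoped ENNReal NNReal
open Literature.Analysis Literature.Analysis.FluidPDE

namespace Summit.NavierStokesRegularity.NavierStokesRegularity.Theorems.BoundedEnvelope

/-! ### The stub -/

/-- **Stub Z5 of the registered line of the crux `BoundedEnvelopeContinuation`:
`¬ LocalTypeISingularityExists` implies the Morrey–Liouville statement (L_M).** If no suitable
weak solution of the unforced unit-viscosity system has an Albritton–Barker Type I singular point,
then a bounded ancient mild solution `v` (`ν = 1`), jointly smooth and Oseen-mild on
`(-∞,0) × (EuclideanSpace ℝ (Fin 3))`, with `∫_{B_r(y)} ‖v t‖² ≤ M' r` for all `t < 0`, `y`, `r > 0`, vanishes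
identically. Otherwise, with the classical pressure `P` of
`HardyAncientLimit.exists_isClassicalNSSolutionOn_Iio_of_oseen`, `(v, P)` is a suitable weak
solution on the past slab with weak gradient `∇v`, not a.e. zero, and with `𝐈((EuclideanSpace ℝ (Fin 3)) × ℝ₋) < ∞`
(`typeIBound_slab_lt_top_of_morrey`): a witness of `NontrivialMildAncientTypeIExists`, whence a
Type I singular point by the proved reverse direction of Albritton–Barker 2019, Thm 1.1
(`localTypeISingularityExists_of_nontrivialMildAncientTypeIExists` with `SuitableCompactness_holds`,
`PersistenceOfSingularities_holds`). [cite: AlbrittonBarker2019, Thm. 1.1 and Lemma 2.6] -/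
theorem stub_liouvilleMorreyOfNoLocalTypeI :
    ¬ Literature.Analysis.FluidPDE.LocalTypeISingularityExists →
    ∀ v : ℝ → EuclideanSpace ℝ (Fin 3) → EuclideanSpace ℝ (Fin 3),
      IsBoundedAncientMildSolution 1 v →
      ContDiffOn ℝ (⊤ : ℕ∞) (uncurry v) (Set.Iio 0 ×ˢ Set.univ) →
      (∀ s t : ℝ, s < t → t < 0 → ∀ x,
        v t x = UnboundedOperators.heatExtension (v s) (t - s) x - oseenDuhamel 1 s v v t x) →
      (∃ M' : ℝ, ∀ t < 0, ∀ (y : EuclideanSpace ℝ (Fin 3)) (r : ℝ), 0 < r →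
        ∫ x in Metric.ball y r, ‖v t x‖ ^ 2 ≤ M' * r) →
      ∀ t < 0, ∀ x, v t x = 0 := by
  intro hno v hmild hsm hoseen hMor t ht x
  by_contra hx
  apply hno
  obtain ⟨M', hM'⟩ := hMor
  -- non-negative constants
  set M : ℝ := max M' 0 with hMdef
  have hM0 : 0 ≤ M := le_max_right _ _
  have hMorM : ∀ t < 0, ∀ (y : (EuclideanSpace ℝ (Fin 3))) (r : ℝ), 0 < r → ∫ x in ball y r, ‖v t x‖ ^ 2 ≤ M * r :=
    fun t ht y r hr => (hM' t ht y r hr).trans (mul_le_mul_of_nonneg_right (le_max_left _ _) hr.le)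
  obtain ⟨V', hV'⟩ := hmild.2
  set V : ℝ := max V' 0 with hVdef
  have hV0 : 0 ≤ V := le_max_right _ _
  have hbd : ∀ t < 0, ∀ x, ‖v t x‖ ≤ V := fun t ht x => (hV' t ht x).trans (le_max_left _ _)
  have hcont : ContinuousOn (uncurry v) (Iio (0 : ℝ) ×ˢ univ) := hsm.continuousOn
  -- the classical pressure
  obtain ⟨P, hcl⟩ :=
    HardyAncientLimit.exists_isClassicalNSSolutionOn_Iio_of_oseen hcont hV0 hbd hmild.1 hoseen
  have hQ : (((Literature.Analysis.FluidPDE.slab (EuclideanSpace ℝ (Fin 3)) (Set.Iio (0 : ℝ)) isOpen_Iio) : TopologicalSpace.Opens (ℝ × (EuclideanSpace ℝ (Fin 3)))) : Set (ℝ × (EuclideanSpace ℝ (Fin 3)))) ⊆ Iio (0 : ℝ) ×ˢ univ := by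
    rw [coe_slab]
  have hsw : IsSuitableWeakSolutionOn (Literature.Analysis.FluidPDE.slab (EuclideanSpace ℝ (Fin 3)) (Set.Iio (0 : ℝ)) isOpen_Iio) 1 0 v P := by
    refine isSuitableWeakSolutionOn_of_contDiffOn isOpen_Iio hQ
      (hcl.smooth_velocity.of_le (by norm_cast)) (hcl.smooth_pressure.of_le (by norm_cast))
      continuousOn_const (fun t ht x => ?_) hcl.divFree
    have hmom := hcl.momentum t ht x
    rwa [timeDerivWithin_apply, derivWithin_of_isOpen isOpen_Iio ht, ← timeDeriv_apply] at hmom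
  have hwg : HasWeakSpatialGradientOn (Literature.Analysis.FluidPDE.slab (EuclideanSpace ℝ (Fin 3)) (Set.Iio (0 : ℝ)) isOpen_Iio) v fun t x => fderiv ℝ (v t) x :=
    hasWeakSpatialGradientOn_of_contDiffOn isOpen_Iio hQ (hcl.smooth_velocity.of_le (by norm_cast))
  have hnt : ¬ (uncurry v =ᵐ[volume.restrict (Iio (0 : ℝ) ×ˢ (univ : Set (EuclideanSpace ℝ (Fin 3))))] 0) :=
    RellichScarApexLocalisation.not_ae_eq_zero_of_continuousOn hcont ht hx
  have hI := typeIBound_slab_lt_top_of_morrey hM0 hV0 hcl hMorM hbd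
  exact localTypeISingularityExists_of_nontrivialMildAncientTypeIExists SuitableCompactness_holds
    PersistenceOfSingularities_holds ⟨v, P, _, hmild, hsw, hwg, hnt, hI⟩

end Summit.NavierStokesRegularity.NavierStokesRegularity.Theorems.BoundedEnvelope

end
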